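import Summits.ResolutionOfSingularities.ResolutionOfSingularities.Theorems.PurelyInseparableDim4PureLeafUnitOddReservoir
import HarnessLib
import HarnessLib.Audit.Tags

/-!
# Purely inseparable fourfolds — UNIFORM THEOREM: every unit leaf `x₀·x₁^m·x₂^{2b}·x₃^{2c}·(1+x₀)` (`m` odd; any even dress on `x₂, x₃`) is an A-WIN of the plain game over `𝔽₂` ‖ K
# (cell res-dim4-pi; brick (δ) «unit leaves x^a(1+x_j)», UNIFORM family «a₀ = 1, one odd partner, even rest») [OURS · counted 0 · a theorem about OUR coordinate-centre frame v4, not about resolution]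

Width seat `res-dim4-p-10` (g5).  The first uniform theorem INTO the «odd-odd» part of the unit-leaf census (memo
`pub/res-dim4/res-dim4-p-10/UNIT-CLASS-TEXT.md`): p-10 g4 proved `a_j` EVEN (`…PureLeafUnitEven`, p702830) and `a_j` odd with ALL
other exponents even (`…PureLeafUnitPthPower`, p703461); here `a₀ = 1`, the partner exponent `a₁ = m` ODD, the two remaining
exponents even — with an arbitrary even DRESS `S² = x₂^{g₂}(1+x₂)^{e₂}x₃^{g₃}(1+x₃)^{e₃}` (the class must be closed under B's swaps).

* `step_F_grind1_A` — at `A_m := x₀x₁^m(1+x₀)·S²`, `m ≥ 3`, every reply to A's centre `{x₁}` presents `A_{m−2}` with a swapped dress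
  (the `x₀`-translation is a symmetry of `x₀(1+x₀)`, p-10 g2's (α) lemma `step_F_of_purelyOdd`);
* `stateWins_pair_A1` — at `A_1 = x₀x₁(1+x₀)·S²` A plays the FORCED PAIR `{x₀, x₁}`: the chart-`x₀` replies present
  `x₁(1+x₀)·S′²` (a member of D3b's product class, `stateWins_prod_class` p684251) or the L-state `S′²((1+x₀)(1+x₁)+1)`
  (`stateWins_L_class`); the chart-`x₁` replies present the `Q`-state `S′²(x₀ + x₀²x₁)` or the `R`-state `S′²(x₀ + x₁ + x₀²x₁)`,
  A-wins by `…PureLeafUnitOddReservoir` («the reservoir cannot be cashed»: B's located escape to the magic curve needs an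
  order-2 translate of `x₀(1 + x₀x₁)`, and there is none);
* **`stateWins_A`** (induction on `m`) and the leaf form **`stateWins_unitLeaf_oneOdd`**: for every `a : Fin 4 → ℕ` with `a₀ = 1`,
  `a₁` odd, `a₂, a₃` even and EVERY booking, `StateWins 2 ⟨x^a·(1+x₀), r, exc⟩` over `𝔽₂`.  Census instances: 1122, 1322 (the
  renamed ones 1212, 1221, 1223, 1232 follow by `PureLeafGlobalWin.stateWins_rename`; larger members 1144, 1342, 1522, 3?‑‑ no:
  `a₀ = 1` only — `a₀ = 3` is NOT covered, and `a₀ = 5` fails already in the liberal 2-variable abstraction, seat note §9).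

Riders: `𝔽₂`-rational replies (the game over `ZMod 2`); the PLAIN coordinate game of OUR frame v4 (`StateWins 2`), not MODE 1h
and not CJS's algorithm; nothing here proves F4-C(2,2), `Terminates1h 2 2` or resolution of singularities in dimension ≥ 4 /
characteristic `p`; counted 0; AI kernel work, weaker than expert review. bears_on: LADDER-RESOLUTION:D157-DOOR2 (res-dim4-pi ·
brick (δ) · unit-leaf row, uniform theorem). Supports stmt-ResolutionOfSingularities-16155 (helper).
-/

set_option linter.dupNamespace false

open MvPolynomial Finset

open scoped BigOperators

noncomputable section

namespace Summit.ResolutionOfSingularities.ResolutionOfSingularities.Theorems.PIDim4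

namespace PureLeafNF

open Literature.AlgebraicGeometry.Resolution
open Literature.AlgebraicGeometry.Resolution.Hauser2010
open CentreBlowup PthPowerFactor

/-! ## 1. The pair centre `{x₀, x₁}` on the monomials `x₀x₁`, `x₀²x₁` and on the dress -/

/-- `chartTransform 2 {x₀,x₁} x₀ (x₀x₁) = x₁`. [folklore] -/
theorem chartTransform_pair01_zero_XX :
    chartTransform 2 ({0, 1} : Finset (Fin 4)) 0 (X 0 * X 1 : MvPolynomial (Fin 4) (ZMod 2)) = X 1 :=
  chartTransform_pair_XX (by decide)

/-- `chartTransform 2 {x₀,x₁} x₁ (x₀x₁) = x₀`. [folklore] -/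
theorem chartTransform_pair01_one_XX :
    chartTransform 2 ({0, 1} : Finset (Fin 4)) 1 (X 0 * X 1 : MvPolynomial (Fin 4) (ZMod 2)) = X 0 := by
  rw [Finset.pair_comm, mul_comm]
  exact chartTransform_pair_XX (by decide)

/-- `chartTransform 2 {x₀,x₁} x₀ (x₀²x₁) = x₀x₁`. [folklore] -/
theorem chartTransform_pair01_zero_XsqX :
    chartTransform 2 ({0, 1} : Finset (Fin 4)) 0 (X 0 ^ 2 * X 1 : MvPolynomial (Fin 4) (ZMod 2)) = X 0 * X 1 := by
  have h1 : (X 0 ^ 2 * X 1 : MvPolynomial (Fin 4) (ZMod 2)) = monomial (Finsupp.single 0 2 + Finsupp.single 1 1) 1 := by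
    rw [X_pow_eq_monomial, X, monomial_mul, one_mul]
  have h2 : (X 0 * X 1 : MvPolynomial (Fin 4) (ZMod 2)) = monomial (Finsupp.single 0 1 + Finsupp.single 1 1) 1 := by
    rw [X, X, monomial_mul, one_mul]
  have hexp : chartExponent 2 ({0, 1} : Finset (Fin 4)) 0 (Finsupp.single 0 2 + Finsupp.single 1 1) =
      Finsupp.single 0 1 + Finsupp.single 1 1 := by
    rw [chartExponent_eq_iff, degIn_pair (show (0 : Fin 4) ≠ 1 by decide)]
    refine ⟨by simp, fun i hi => ?_⟩
    simp [Finsupp.single_apply, Ne.symm hi]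
  rw [h1, h2, chartTransform_monomial, hexp]

/-- `chartTransform 2 {x₀,x₁} x₁ (x₀²x₁) = x₀²x₁`. [folklore] -/
theorem chartTransform_pair01_one_XsqX :
    chartTransform 2 ({0, 1} : Finset (Fin 4)) 1 (X 0 ^ 2 * X 1 : MvPolynomial (Fin 4) (ZMod 2)) = X 0 ^ 2 * X 1 := by
  have h1 : (X 0 ^ 2 * X 1 : MvPolynomial (Fin 4) (ZMod 2)) = monomial (Finsupp.single 0 2 + Finsupp.single 1 1) 1 := by
    rw [X_pow_eq_monomial, X, monomial_mul, one_mul]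
  have hexp : chartExponent 2 ({0, 1} : Finset (Fin 4)) 1 (Finsupp.single 0 2 + Finsupp.single 1 1) =
      Finsupp.single 0 2 + Finsupp.single 1 1 := by
    rw [chartExponent_eq_iff, degIn_pair (show (0 : Fin 4) ≠ 1 by decide)]
    refine ⟨by simp, fun i hi => ?_⟩
    simp [Finsupp.single_apply, Ne.symm hi]
  rw [h1, chartTransform_monomial, hexp]

/-- The dress `S² = x₂^{g₂}(1+x₂)^{e₂}x₃^{g₃}(1+x₃)^{e₃}` is supported off `{x₀, x₁}`. [folklore] -/
theorem support_dress_off (g2 g3 e2 e3 : ℕ) :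
    ∀ d ∈ (∏ l, X l ^ (![0, 0, g2, g3] : Fin 4 → ℕ) l * (1 + X l) ^ (![0, 0, e2, e3] : Fin 4 → ℕ) l : MvPolynomial (Fin 4) (ZMod 2)).support, ∀ i ∈ ({0, 1} : Finset (Fin 4)), d i = 0 := by
  have h := support_cofactor_off (K := ZMod 2) (![0, 0, g2, g3] : Fin 4 → ℕ) (![0, 0, e2, e3] : Fin 4 → ℕ) (j := 0) (k := 1)
    (by simp) (by simp)
  have hupd : Function.update (Function.update (![0, 0, g2, g3] : Fin 4 → ℕ) 0 0) 1 0 = ![0, 0, g2, g3] := by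
    funext l; fin_cases l <;> simp
  rw [hupd] at h
  exact h

/-- `x₀x₁(1+x₀)·S² = x₀x₁·S² + x₀²x₁·S²`. [folklore] -/
theorem A1_eq_add (g2 g3 e2 e3 : ℕ) :
    (∏ l, X l ^ (![1, 1, g2, g3] : Fin 4 → ℕ) l * (1 + X l) ^ (![1, 0, e2, e3] : Fin 4 → ℕ) l : MvPolynomial (Fin 4) (ZMod 2)) = (∏ l, X l ^ (![1, 1, g2, g3] : Fin 4 → ℕ) l * (1 + X l) ^ (![0, 0, e2, e3] : Fin 4 → ℕ) l : MvPolynomial (Fin 4) (ZMod 2)) + (∏ l, X l ^ (![2, 1, g2, g3] : Fin 4 → ℕ) l * (1 + X l) ^ (![0, 0, e2, e3] : Fin 4 → ℕ) l : MvPolynomial (Fin 4) (ZMod 2)) := by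
  have hI := prod_update_e_succ (![1, 1, g2, g3] : Fin 4 → ℕ) (![0, 0, e2, e3] : Fin 4 → ℕ) 0
  have h1 : Function.update (![0, 0, e2, e3] : Fin 4 → ℕ) 0 ((![0, 0, e2, e3] : Fin 4 → ℕ) 0 + 1) = ![1, 0, e2, e3] := by
    funext l; fin_cases l <;> simp
  have h2 : Function.update (![1, 1, g2, g3] : Fin 4 → ℕ) 0 ((![1, 1, g2, g3] : Fin 4 → ℕ) 0 + 1) = ![2, 1, g2, g3] := by
    funext l; fin_cases l <;> simp
  rw [h1, h2] at hI
  exact hI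

/-- `x₀x₁·S² = (x₀x₁)·S²` with the dress pulled out. [folklore] -/
theorem XX_dress (g2 g3 e2 e3 : ℕ) :
    (∏ l, X l ^ (![1, 1, g2, g3] : Fin 4 → ℕ) l * (1 + X l) ^ (![0, 0, e2, e3] : Fin 4 → ℕ) l : MvPolynomial (Fin 4) (ZMod 2)) = (X 0 * X 1) * (∏ l, X l ^ (![0, 0, g2, g3] : Fin 4 → ℕ) l * (1 + X l) ^ (![0, 0, e2, e3] : Fin 4 → ℕ) l : MvPolynomial (Fin 4) (ZMod 2)) := by
  rw [mul_assoc, X_mul_prod', X_mul_prod']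
  congr 1; funext l; fin_cases l <;> simp

/-- `x₀²x₁·S² = (x₀²x₁)·S²`. [folklore] -/
theorem XsqX_dress (g2 g3 e2 e3 : ℕ) :
    (∏ l, X l ^ (![2, 1, g2, g3] : Fin 4 → ℕ) l * (1 + X l) ^ (![0, 0, e2, e3] : Fin 4 → ℕ) l : MvPolynomial (Fin 4) (ZMod 2)) = (X 0 ^ 2 * X 1) * (∏ l, X l ^ (![0, 0, g2, g3] : Fin 4 → ℕ) l * (1 + X l) ^ (![0, 0, e2, e3] : Fin 4 → ℕ) l : MvPolynomial (Fin 4) (ZMod 2)) := by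
  rw [pow_two, mul_assoc, mul_assoc, X_mul_prod', X_mul_prod', X_mul_prod']
  congr 1; funext l; fin_cases l <;> simp

/-- `x₁·S²` as a product. [folklore] -/
theorem X1_dress (g2 g3 e2 e3 : ℕ) :
    (X 1 : MvPolynomial (Fin 4) (ZMod 2)) * (∏ l, X l ^ (![0, 0, g2, g3] : Fin 4 → ℕ) l * (1 + X l) ^ (![0, 0, e2, e3] : Fin 4 → ℕ) l : MvPolynomial (Fin 4) (ZMod 2)) = (∏ l, X l ^ (![0, 1, g2, g3] : Fin 4 → ℕ) l * (1 + X l) ^ (![0, 0, e2, e3] : Fin 4 → ℕ) l : MvPolynomial (Fin 4) (ZMod 2)) := by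
  rw [X_mul_prod']; congr 1; funext l; fin_cases l <;> simp

/-- `x₀·S²` as a product. [folklore] -/
theorem X0_dress (g2 g3 e2 e3 : ℕ) :
    (X 0 : MvPolynomial (Fin 4) (ZMod 2)) * (∏ l, X l ^ (![0, 0, g2, g3] : Fin 4 → ℕ) l * (1 + X l) ^ (![0, 0, e2, e3] : Fin 4 → ℕ) l : MvPolynomial (Fin 4) (ZMod 2)) = (∏ l, X l ^ (![1, 0, g2, g3] : Fin 4 → ℕ) l * (1 + X l) ^ (![0, 0, e2, e3] : Fin 4 → ℕ) l : MvPolynomial (Fin 4) (ZMod 2)) := by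
  rw [X_mul_prod']; congr 1; funext l; fin_cases l <;> simp

/-! ## 2. The forced pair `{x₀, x₁}` at `A_1 = x₀x₁(1+x₀)·S²` -/

/-- **Chart `x₀` of the pair move at `A_1`**: the cleaned transform is the D3b product `x₁(1+x₀)·S′²` (if `b₁ = 0`) or the
D3b L-state `S′²((1+x₀)(1+x₁)+1)` (if `b₁ = 1`), `S′²` the swapped dress. [folklore] -/
theorem step_F_pair0_A1 (g2 g3 e2 e3 : ℕ) (hg2 : g2 % 2 = 0) (hg3 : g3 % 2 = 0) (he2 : e2 % 2 = 0) (he3 : e3 % 2 = 0) (b : Fin 4 → ZMod 2) (hb : b 0 = 0)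
    (r : Fin 4 →₀ ℕ) (exc : Finset (Fin 4)) :
    ((step 2 ({0, 1} : Finset (Fin 4)) 0 b (⟨(∏ l, X l ^ (![1, 1, g2, g3] : Fin 4 → ℕ) l * (1 + X l) ^ (![1, 0, e2, e3] : Fin 4 → ℕ) l : MvPolynomial (Fin 4) (ZMod 2)), r, exc⟩ : State (ZMod 2))).F =
        (∏ l, X l ^ (![0, 1, (if b 2 = 0 then g2 else e2), (if b 3 = 0 then g3 else e3)] : Fin 4 → ℕ) l * (1 + X l) ^ (![1, 0, (if b 2 = 0 then e2 else g2), (if b 3 = 0 then e3 else g3)] : Fin 4 → ℕ) l : MvPolynomial (Fin 4) (ZMod 2)) ∧ b 1 = 0) ∨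
    ((step 2 ({0, 1} : Finset (Fin 4)) 0 b (⟨(∏ l, X l ^ (![1, 1, g2, g3] : Fin 4 → ℕ) l * (1 + X l) ^ (![1, 0, e2, e3] : Fin 4 → ℕ) l : MvPolynomial (Fin 4) (ZMod 2)), r, exc⟩ : State (ZMod 2))).F =
        ((∏ l, X l ^ (![0, 0, (if b 2 = 0 then g2 else e2), (if b 3 = 0 then g3 else e3)] : Fin 4 → ℕ) l * (1 + X l) ^ (![0, 0, (if b 2 = 0 then e2 else g2), (if b 3 = 0 then e3 else g3)] : Fin 4 → ℕ) l : MvPolynomial (Fin 4) (ZMod 2)) * ((∏ l, X l ^ (0 : ℕ) * (1 + X l) ^ (if l ∈ (({0, 1} : Finset (Fin 4))) then 1 else 0) : MvPolynomial (Fin 4) (ZMod 2)) + 1)) ∧ b 1 = 1) := by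
  have hP : ∀ n : ℕ, n % 2 = 0 → ∀ n' : ℕ, n' % 2 = 0 → ∀ z : ZMod 2, (if z = 0 then n else n') % 2 = 0 := by
    intro n hn n' hn' z; split_ifs <;> assumption
  have hp' := hP _ hg2 _ he2 (b 2); have hq' := hP _ hg3 _ he3 (b 3); have hr' := hP _ he2 _ hg2 (b 2); have hs' := hP _ he3 _ hg3 (b 3)
  change deletePthPowers 2 (PointBlowup.translate b (chartTransform 2 {0, 1} 0 (∏ l, X l ^ (![1, 1, g2, g3] : Fin 4 → ℕ) l * (1 + X l) ^ (![1, 0, e2, e3] : Fin 4 → ℕ) l : MvPolynomial (Fin 4) (ZMod 2)))) = _ ∧ _ ∨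
    deletePthPowers 2 (PointBlowup.translate b (chartTransform 2 {0, 1} 0 (∏ l, X l ^ (![1, 1, g2, g3] : Fin 4 → ℕ) l * (1 + X l) ^ (![1, 0, e2, e3] : Fin 4 → ℕ) l : MvPolynomial (Fin 4) (ZMod 2)))) = _ ∧ _
  rw [A1_eq_add, chartTransform_add, XX_dress, XsqX_dress,
    MohAlong.chartTransform_mul_offS (by simp) 2 _ _ (support_dress_off g2 g3 e2 e3),
    MohAlong.chartTransform_mul_offS (by simp) 2 _ _ (support_dress_off g2 g3 e2 e3),
    chartTransform_pair01_zero_XX, chartTransform_pair01_zero_XsqX, X1_dress, ← XX_dress,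
    MohAlong.translate_add, translate_prod_zmod2, translate_prod_zmod2, deletePthPowers_add]
  rcases (by decide : ∀ z : ZMod 2, z = 0 ∨ z = 1) (b 1) with h1 | h1
  · left
    refine ⟨?_, h1⟩
    rw [show (∏ l, X l ^ (if b l = 0 then (![0, 1, g2, g3] : Fin 4 → ℕ) l else (![0, 0, e2, e3] : Fin 4 → ℕ) l) *
        (1 + X l) ^ (if b l = 0 then (![0, 0, e2, e3] : Fin 4 → ℕ) l else (![0, 1, g2, g3] : Fin 4 → ℕ) l) : MvPolynomial (Fin 4) (ZMod 2)) =
        (∏ l, X l ^ (![0, 1, (if b 2 = 0 then g2 else e2), (if b 3 = 0 then g3 else e3)] : Fin 4 → ℕ) l * (1 + X l) ^ (![0, 0, (if b 2 = 0 then e2 else g2), (if b 3 = 0 then e3 else g3)] : Fin 4 → ℕ) l : MvPolynomial (Fin 4) (ZMod 2)) from Finset.prod_congr rfl fun l _ => by fin_cases l <;> simp [hb, h1],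
      show (∏ l, X l ^ (if b l = 0 then (![1, 1, g2, g3] : Fin 4 → ℕ) l else (![0, 0, e2, e3] : Fin 4 → ℕ) l) *
        (1 + X l) ^ (if b l = 0 then (![0, 0, e2, e3] : Fin 4 → ℕ) l else (![1, 1, g2, g3] : Fin 4 → ℕ) l) : MvPolynomial (Fin 4) (ZMod 2)) =
        (∏ l, X l ^ (![1, 1, (if b 2 = 0 then g2 else e2), (if b 3 = 0 then g3 else e3)] : Fin 4 → ℕ) l * (1 + X l) ^ (![0, 0, (if b 2 = 0 then e2 else g2), (if b 3 = 0 then e3 else g3)] : Fin 4 → ℕ) l : MvPolynomial (Fin 4) (ZMod 2)) from Finset.prod_congr rfl fun l _ => by fin_cases l <;> simp [hb, h1],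
      deletePthPowers_prod_of_purelyOdd (![0, 1, (if b 2 = 0 then g2 else e2), (if b 3 = 0 then g3 else e3)] : Fin 4 → ℕ) (![0, 0, (if b 2 = 0 then e2 else g2), (if b 3 = 0 then e3 else g3)] : Fin 4 → ℕ) (l := 1) (by simp) (by simp),
      deletePthPowers_prod_of_purelyOdd (![1, 1, (if b 2 = 0 then g2 else e2), (if b 3 = 0 then g3 else e3)] : Fin 4 → ℕ) (![0, 0, (if b 2 = 0 then e2 else g2), (if b 3 = 0 then e3 else g3)] : Fin 4 → ℕ) (l := 1) (by simp) (by simp)]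
    have hI := prod_update_e_succ (![0, 1, (if b 2 = 0 then g2 else e2), (if b 3 = 0 then g3 else e3)] : Fin 4 → ℕ) (![0, 0, (if b 2 = 0 then e2 else g2), (if b 3 = 0 then e3 else g3)] : Fin 4 → ℕ) 0
    have e1 : Function.update (![0, 0, (if b 2 = 0 then e2 else g2), (if b 3 = 0 then e3 else g3)] : Fin 4 → ℕ) 0 ((![0, 0, (if b 2 = 0 then e2 else g2), (if b 3 = 0 then e3 else g3)] : Fin 4 → ℕ) 0 + 1) = ![1, 0, (if b 2 = 0 then e2 else g2), (if b 3 = 0 then e3 else g3)] := by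
      funext l; fin_cases l <;> simp
    have e2' : Function.update (![0, 1, (if b 2 = 0 then g2 else e2), (if b 3 = 0 then g3 else e3)] : Fin 4 → ℕ) 0 ((![0, 1, (if b 2 = 0 then g2 else e2), (if b 3 = 0 then g3 else e3)] : Fin 4 → ℕ) 0 + 1) = ![1, 1, (if b 2 = 0 then g2 else e2), (if b 3 = 0 then g3 else e3)] := by
      funext l; fin_cases l <;> simp
    rw [e1, e2'] at hI
    exact hI.symm
  · right
    refine ⟨?_, h1⟩
    rw [show (∏ l, X l ^ (if b l = 0 then (![0, 1, g2, g3] : Fin 4 → ℕ) l else (![0, 0, e2, e3] : Fin 4 → ℕ) l) *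
        (1 + X l) ^ (if b l = 0 then (![0, 0, e2, e3] : Fin 4 → ℕ) l else (![0, 1, g2, g3] : Fin 4 → ℕ) l) : MvPolynomial (Fin 4) (ZMod 2)) =
        (∏ l, X l ^ (![0, 0, (if b 2 = 0 then g2 else e2), (if b 3 = 0 then g3 else e3)] : Fin 4 → ℕ) l * (1 + X l) ^ (![0, 1, (if b 2 = 0 then e2 else g2), (if b 3 = 0 then e3 else g3)] : Fin 4 → ℕ) l : MvPolynomial (Fin 4) (ZMod 2)) from Finset.prod_congr rfl fun l _ => by fin_cases l <;> simp [hb, h1],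
      show (∏ l, X l ^ (if b l = 0 then (![1, 1, g2, g3] : Fin 4 → ℕ) l else (![0, 0, e2, e3] : Fin 4 → ℕ) l) *
        (1 + X l) ^ (if b l = 0 then (![0, 0, e2, e3] : Fin 4 → ℕ) l else (![1, 1, g2, g3] : Fin 4 → ℕ) l) : MvPolynomial (Fin 4) (ZMod 2)) =
        (∏ l, X l ^ (![1, 0, (if b 2 = 0 then g2 else e2), (if b 3 = 0 then g3 else e3)] : Fin 4 → ℕ) l * (1 + X l) ^ (![0, 1, (if b 2 = 0 then e2 else g2), (if b 3 = 0 then e3 else g3)] : Fin 4 → ℕ) l : MvPolynomial (Fin 4) (ZMod 2)) from Finset.prod_congr rfl fun l _ => by fin_cases l <;> simp [hb, h1],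
      clean_flip1 _ _ _ _ hp' hq' hr' hs',
      deletePthPowers_prod_of_purelyOdd (![1, 0, (if b 2 = 0 then g2 else e2), (if b 3 = 0 then g3 else e3)] : Fin 4 → ℕ) (![0, 1, (if b 2 = 0 then e2 else g2), (if b 3 = 0 then e3 else g3)] : Fin 4 → ℕ) (l := 0) (by simp) (by simp)]
    -- `x₁S′² + x₀(1+x₁)S′² = S′²·((1+x₀)(1+x₁) + 1)` in characteristic 2
    rw [← X1_dress, show (∏ l, X l ^ (![1, 0, (if b 2 = 0 then g2 else e2), (if b 3 = 0 then g3 else e3)] : Fin 4 → ℕ) l * (1 + X l) ^ (![0, 1, (if b 2 = 0 then e2 else g2), (if b 3 = 0 then e3 else g3)] : Fin 4 → ℕ) l : MvPolynomial (Fin 4) (ZMod 2)) = X 0 * ((1 + X 1) * (∏ l, X l ^ (![0, 0, (if b 2 = 0 then g2 else e2), (if b 3 = 0 then g3 else e3)] : Fin 4 → ℕ) l * (1 + X l) ^ (![0, 0, (if b 2 = 0 then e2 else g2), (if b 3 = 0 then e3 else g3)] : Fin 4 → ℕ) l : MvPolynomial (Fin 4) (ZMod 2))) by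
      rw [one_add_X_mul_prod, X_mul_prod']; exact Finset.prod_congr rfl fun l _ => by fin_cases l <;> simp]
    have h4 : (∏ l, X l ^ (0 : ℕ) * (1 + X l) ^ (if l ∈ (({0, 1} : Finset (Fin 4))) then 1 else 0) : MvPolynomial (Fin 4) (ZMod 2)) =
        (1 + X 0) * (1 + X 1) := by
      rw [Fin.prod_univ_four]; simp
    rw [h4]
    have hc := add_self_eq_zero' (∏ l, X l ^ (![0, 0, (if b 2 = 0 then g2 else e2), (if b 3 = 0 then g3 else e3)] : Fin 4 → ℕ) l * (1 + X l) ^ (![0, 0, (if b 2 = 0 then e2 else g2), (if b 3 = 0 then e3 else g3)] : Fin 4 → ℕ) l : MvPolynomial (Fin 4) (ZMod 2))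
    linear_combination (-1 : MvPolynomial (Fin 4) (ZMod 2)) * hc

/-- **Chart `x₁` of the pair move at `A_1`**: the cleaned transform is the `Q`-state (if `b₀ = 0`) or the `R`-state (if `b₀ = 1`)
of the swapped dress. [folklore] -/
theorem step_F_pair1_A1 (g2 g3 e2 e3 : ℕ) (hg2 : g2 % 2 = 0) (hg3 : g3 % 2 = 0) (he2 : e2 % 2 = 0) (he3 : e3 % 2 = 0) (b : Fin 4 → ZMod 2) (hb : b 1 = 0)
    (r : Fin 4 →₀ ℕ) (exc : Finset (Fin 4)) :
    ((step 2 ({0, 1} : Finset (Fin 4)) 1 b (⟨(∏ l, X l ^ (![1, 1, g2, g3] : Fin 4 → ℕ) l * (1 + X l) ^ (![1, 0, e2, e3] : Fin 4 → ℕ) l : MvPolynomial (Fin 4) (ZMod 2)), r, exc⟩ : State (ZMod 2))).F =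
        ((∏ l, X l ^ (![1, 0, (if b 2 = 0 then g2 else e2), (if b 3 = 0 then g3 else e3)] : Fin 4 → ℕ) l * (1 + X l) ^ (![0, 0, (if b 2 = 0 then e2 else g2), (if b 3 = 0 then e3 else g3)] : Fin 4 → ℕ) l : MvPolynomial (Fin 4) (ZMod 2)) + (∏ l, X l ^ (![2, 1, (if b 2 = 0 then g2 else e2), (if b 3 = 0 then g3 else e3)] : Fin 4 → ℕ) l * (1 + X l) ^ (![0, 0, (if b 2 = 0 then e2 else g2), (if b 3 = 0 then e3 else g3)] : Fin 4 → ℕ) l : MvPolynomial (Fin 4) (ZMod 2))) ∧ b 0 = 0) ∨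
    ((step 2 ({0, 1} : Finset (Fin 4)) 1 b (⟨(∏ l, X l ^ (![1, 1, g2, g3] : Fin 4 → ℕ) l * (1 + X l) ^ (![1, 0, e2, e3] : Fin 4 → ℕ) l : MvPolynomial (Fin 4) (ZMod 2)), r, exc⟩ : State (ZMod 2))).F =
        ((∏ l, X l ^ (![1, 0, (if b 2 = 0 then g2 else e2), (if b 3 = 0 then g3 else e3)] : Fin 4 → ℕ) l * (1 + X l) ^ (![0, 0, (if b 2 = 0 then e2 else g2), (if b 3 = 0 then e3 else g3)] : Fin 4 → ℕ) l : MvPolynomial (Fin 4) (ZMod 2)) + (∏ l, X l ^ (![0, 1, (if b 2 = 0 then g2 else e2), (if b 3 = 0 then g3 else e3)] : Fin 4 → ℕ) l * (1 + X l) ^ (![0, 0, (if b 2 = 0 then e2 else g2), (if b 3 = 0 then e3 else g3)] : Fin 4 → ℕ) l : MvPolynomial (Fin 4) (ZMod 2)) + (∏ l, X l ^ (![2, 1, (if b 2 = 0 then g2 else e2), (if b 3 = 0 then g3 else e3)] : Fin 4 → ℕ) l * (1 + X l) ^ (![0, 0, (if b 2 = 0 then e2 else g2), (if b 3 = 0 then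 e3 else g3)] : Fin 4 → ℕ) l : MvPolynomial (Fin 4) (ZMod 2))) ∧ b 0 = 1) := by
  have hP : ∀ n : ℕ, n % 2 = 0 → ∀ n' : ℕ, n' % 2 = 0 → ∀ z : ZMod 2, (if z = 0 then n else n') % 2 = 0 := by
    intro n hn n' hn' z; split_ifs <;> assumption
  have hp' := hP _ hg2 _ he2 (b 2); have hq' := hP _ hg3 _ he3 (b 3); have hr' := hP _ he2 _ hg2 (b 2); have hs' := hP _ he3 _ hg3 (b 3)
  change deletePthPowers 2 (PointBlowup.translate b (chartTransform 2 {0, 1} 1 (∏ l, X l ^ (![1, 1, g2, g3] : Fin 4 → ℕ) l * (1 + X l) ^ (![1, 0, e2, e3] : Fin 4 → ℕ) l : MvPolynomial (Fin 4) (ZMod 2)))) = _ ∧ _ ∨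
    deletePthPowers 2 (PointBlowup.translate b (chartTransform 2 {0, 1} 1 (∏ l, X l ^ (![1, 1, g2, g3] : Fin 4 → ℕ) l * (1 + X l) ^ (![1, 0, e2, e3] : Fin 4 → ℕ) l : MvPolynomial (Fin 4) (ZMod 2)))) = _ ∧ _
  rw [A1_eq_add, chartTransform_add, XX_dress, XsqX_dress,
    MohAlong.chartTransform_mul_offS (by simp) 2 _ _ (support_dress_off g2 g3 e2 e3),
    MohAlong.chartTransform_mul_offS (by simp) 2 _ _ (support_dress_off g2 g3 e2 e3),
    chartTransform_pair01_one_XX, chartTransform_pair01_one_XsqX, X0_dress, ← XsqX_dress,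
    MohAlong.translate_add, translate_prod_zmod2, translate_prod_zmod2, deletePthPowers_add]
  rcases (by decide : ∀ z : ZMod 2, z = 0 ∨ z = 1) (b 0) with h0 | h0
  · left
    refine ⟨?_, h0⟩
    rw [show (∏ l, X l ^ (if b l = 0 then (![1, 0, g2, g3] : Fin 4 → ℕ) l else (![0, 0, e2, e3] : Fin 4 → ℕ) l) *
        (1 + X l) ^ (if b l = 0 then (![0, 0, e2, e3] : Fin 4 → ℕ) l else (![1, 0, g2, g3] : Fin 4 → ℕ) l) : MvPolynomial (Fin 4) (ZMod 2)) =
        (∏ l, X l ^ (![1, 0, (if b 2 = 0 then g2 else e2), (if b 3 = 0 then g3 else e3)] : Fin 4 → ℕ) l * (1 + X l) ^ (![0, 0, (if b 2 = 0 then e2 else g2), (if b 3 = 0 then e3 else g3)] : Fin 4 → ℕ) l : MvPolynomial (Fin 4) (ZMod 2)) from Finset.prod_congr rfl fun l _ => by fin_cases l <;> simp [hb, h0],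
      show (∏ l, X l ^ (if b l = 0 then (![2, 1, g2, g3] : Fin 4 → ℕ) l else (![0, 0, e2, e3] : Fin 4 → ℕ) l) *
        (1 + X l) ^ (if b l = 0 then (![0, 0, e2, e3] : Fin 4 → ℕ) l else (![2, 1, g2, g3] : Fin 4 → ℕ) l) : MvPolynomial (Fin 4) (ZMod 2)) =
        (∏ l, X l ^ (![2, 1, (if b 2 = 0 then g2 else e2), (if b 3 = 0 then g3 else e3)] : Fin 4 → ℕ) l * (1 + X l) ^ (![0, 0, (if b 2 = 0 then e2 else g2), (if b 3 = 0 then e3 else g3)] : Fin 4 → ℕ) l : MvPolynomial (Fin 4) (ZMod 2)) from Finset.prod_congr rfl fun l _ => by fin_cases l <;> simp [hb, h0],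
      deletePthPowers_prod_of_purelyOdd (![1, 0, (if b 2 = 0 then g2 else e2), (if b 3 = 0 then g3 else e3)] : Fin 4 → ℕ) (![0, 0, (if b 2 = 0 then e2 else g2), (if b 3 = 0 then e3 else g3)] : Fin 4 → ℕ) (l := 0) (by simp) (by simp),
      deletePthPowers_prod_of_purelyOdd (![2, 1, (if b 2 = 0 then g2 else e2), (if b 3 = 0 then g3 else e3)] : Fin 4 → ℕ) (![0, 0, (if b 2 = 0 then e2 else g2), (if b 3 = 0 then e3 else g3)] : Fin 4 → ℕ) (l := 1) (by simp) (by simp)]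
  · right
    refine ⟨?_, h0⟩
    rw [show (∏ l, X l ^ (if b l = 0 then (![1, 0, g2, g3] : Fin 4 → ℕ) l else (![0, 0, e2, e3] : Fin 4 → ℕ) l) *
        (1 + X l) ^ (if b l = 0 then (![0, 0, e2, e3] : Fin 4 → ℕ) l else (![1, 0, g2, g3] : Fin 4 → ℕ) l) : MvPolynomial (Fin 4) (ZMod 2)) =
        (∏ l, X l ^ (![0, 0, (if b 2 = 0 then g2 else e2), (if b 3 = 0 then g3 else e3)] : Fin 4 → ℕ) l * (1 + X l) ^ (![1, 0, (if b 2 = 0 then e2 else g2), (if b 3 = 0 then e3 else g3)] : Fin 4 → ℕ) l : MvPolynomial (Fin 4) (ZMod 2)) from Finset.prod_congr rfl fun l _ => by fin_cases l <;> simp [hb, h0],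
      show (∏ l, X l ^ (if b l = 0 then (![2, 1, g2, g3] : Fin 4 → ℕ) l else (![0, 0, e2, e3] : Fin 4 → ℕ) l) *
        (1 + X l) ^ (if b l = 0 then (![0, 0, e2, e3] : Fin 4 → ℕ) l else (![2, 1, g2, g3] : Fin 4 → ℕ) l) : MvPolynomial (Fin 4) (ZMod 2)) =
        (∏ l, X l ^ (![0, 1, (if b 2 = 0 then g2 else e2), (if b 3 = 0 then g3 else e3)] : Fin 4 → ℕ) l * (1 + X l) ^ (![2, 0, (if b 2 = 0 then e2 else g2), (if b 3 = 0 then e3 else g3)] : Fin 4 → ℕ) l : MvPolynomial (Fin 4) (ZMod 2)) from Finset.prod_congr rfl fun l _ => by fin_cases l <;> simp [hb, h0],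
      clean_flip0 _ _ _ _ hp' hq' hr' hs',
      deletePthPowers_prod_of_purelyOdd (![0, 1, (if b 2 = 0 then g2 else e2), (if b 3 = 0 then g3 else e3)] : Fin 4 → ℕ) (![2, 0, (if b 2 = 0 then e2 else g2), (if b 3 = 0 then e3 else g3)] : Fin 4 → ℕ) (l := 1) (by simp) (by simp),
      split_dsq0, add_assoc]

/-- **`A_1 = x₀x₁(1+x₀)·S²` wins** (every even dress, every booking): the forced pair `{x₀, x₁}`. [OURS · counted 0] [folklore] -/
theorem stateWins_pair_A1 (g2 g3 e2 e3 : ℕ) (hg2 : g2 % 2 = 0) (hg3 : g3 % 2 = 0) (he2 : e2 % 2 = 0) (he3 : e3 % 2 = 0) (r : Fin 4 →₀ ℕ) (exc : Finset (Fin 4)) :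
    StateWins 2 (⟨(∏ l, X l ^ (![1, 1, g2, g3] : Fin 4 → ℕ) l * (1 + X l) ^ (![1, 0, e2, e3] : Fin 4 → ℕ) l : MvPolynomial (Fin 4) (ZMod 2)), r, exc⟩ : State (ZMod 2)) := by
  have hstate : ∀ t : State (ZMod 2), t = ⟨t.F, t.r, t.exc⟩ := fun t => rfl
  have hP : ∀ n : ℕ, n % 2 = 0 → ∀ n' : ℕ, n' % 2 = 0 → ∀ z : ZMod 2, (if z = 0 then n else n') % 2 = 0 := by
    intro n hn n' hn' z; split_ifs <;> assumption
  unfold StateWins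
  refine Game.Wins.move (m := ({0, 1} : Finset (Fin 4))) ⟨⟨0, by simp⟩, ?_⟩ ?_
  · show (2 : ℕ∞) ≤ ordAlong {0, 1} (∏ l, X l ^ (![1, 1, g2, g3] : Fin 4 → ℕ) l * (1 + X l) ^ (![1, 0, e2, e3] : Fin 4 → ℕ) l : MvPolynomial (Fin 4) (ZMod 2))
    rw [ordAlong_prod, degIn_pair (show (0 : Fin 4) ≠ 1 by decide)]
    simp
  rintro s' ⟨j', b, hj', hbj, -, -, rfl⟩
  rw [hstate (step 2 _ _ b _)]
  simp only [Finset.mem_insert, Finset.mem_singleton] at hj'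
  rcases hj' with rfl | rfl
  · rcases step_F_pair0_A1 g2 g3 e2 e3 hg2 hg3 he2 he3 b hbj r exc with ⟨hF, -⟩ | ⟨hF, -⟩
    · rw [hF]
      have hI5 : ∀ i, (![1, 0, (if b 2 = 0 then e2 else g2), (if b 3 = 0 then e3 else g3)] : Fin 4 → ℕ) i % 2 = 1 → (![0, 1, (if b 2 = 0 then g2 else e2), (if b 3 = 0 then g3 else e3)] : Fin 4 → ℕ) i = 0 := by
        intro i hi
        fin_cases i
        · simp
        · simp at hi
        · exfalso; simp at hi; split_ifs at hi <;> omega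
        · exfalso; simp at hi; split_ifs at hi <;> omega
      have hI6 : ∀ i, (![0, 1, (if b 2 = 0 then g2 else e2), (if b 3 = 0 then g3 else e3)] : Fin 4 → ℕ) i % 2 = 1 → 0 < (![1, 0, (if b 2 = 0 then e2 else g2), (if b 3 = 0 then e3 else g3)] : Fin 4 → ℕ) i →
          ∀ i', i' ≠ i → (![0, 1, (if b 2 = 0 then g2 else e2), (if b 3 = 0 then g3 else e3)] : Fin 4 → ℕ) i' % 2 = 0 ∧ (![1, 0, (if b 2 = 0 then e2 else g2), (if b 3 = 0 then e3 else g3)] : Fin 4 → ℕ) i' % 2 = 0 := by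
        intro i hi hpos i' _
        fin_cases i
        · simp at hi
        · simp at hpos
        · exfalso; simp at hi; split_ifs at hi <;> omega
        · exfalso; simp at hi; split_ifs at hi <;> omega
      exact stateWins_prod_class _ _ hI5 hI6 _ _
    · rw [hF]
      have hp' := hP _ hg2 _ he2 (b 2); have hq' := hP _ hg3 _ he3 (b 3)
      have hr' := hP _ he2 _ hg2 (b 2); have hs' := hP _ he3 _ hg3 (b 3)
      have ha : ∀ i, (![0, 0, (if b 2 = 0 then g2 else e2), (if b 3 = 0 then g3 else e3)] : Fin 4 → ℕ) i % 2 = 0 := by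
        intro i; fin_cases i
        · simp
        · simp
        · simpa using hp'
        · simpa using hq'
      have he : ∀ i, (![0, 0, (if b 2 = 0 then e2 else g2), (if b 3 = 0 then e3 else g3)] : Fin 4 → ℕ) i % 2 = 0 := by
        intro i; fin_cases i
        · simp
        · simp
        · simpa using hr'
        · simpa using hs'
      have haT : ∀ i ∈ (({0, 1} : Finset (Fin 4))), (![0, 0, (if b 2 = 0 then g2 else e2), (if b 3 = 0 then g3 else e3)] : Fin 4 → ℕ) i = 0 := by
        intro i hi
        simp only [Finset.mem_insert, Finset.mem_singleton] at hi
        rcases hi with rfl | rfl <;> simp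
      exact stateWins_L_class _ _ _ ha he haT (by simp) _ _
  · rcases step_F_pair1_A1 g2 g3 e2 e3 hg2 hg3 he2 he3 b hbj r exc with ⟨hF, -⟩ | ⟨hF, -⟩
    · rw [hF]
      exact stateWins_Q _ _ _ _ (hP _ hg2 _ he2 _) (hP _ hg3 _ he3 _) (hP _ he2 _ hg2 _) (hP _ he3 _ hg3 _) _ _
    · rw [hF]
      exact stateWins_R _ _ _ _ (hP _ hg2 _ he2 _) (hP _ hg3 _ he3 _) (hP _ he2 _ hg2 _) (hP _ he3 _ hg3 _) _ _

/-! ## 3. The grind `{x₁}` at `A_m`, `m ≥ 3`, and the induction -/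

/-- **Grind transition at `A_m`** (`m ≥ 3` odd): every reply presents `A_{m−2}` with a swapped dress. [folklore] -/
theorem step_F_grind1_A (m g2 g3 e2 e3 : ℕ) (hm : m % 2 = 1) (hm3 : 3 ≤ m) (b : Fin 4 → ZMod 2) (hb : b 1 = 0)
    (r : Fin 4 →₀ ℕ) (exc : Finset (Fin 4)) :
    (step 2 ({1} : Finset (Fin 4)) 1 b (⟨(∏ l, X l ^ (![1, m, g2, g3] : Fin 4 → ℕ) l * (1 + X l) ^ (![1, 0, e2, e3] : Fin 4 → ℕ) l : MvPolynomial (Fin 4) (ZMod 2)), r, exc⟩ : State (ZMod 2))).F =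
      (∏ l, X l ^ (![1, (m - 2), (if b 2 = 0 then g2 else e2), (if b 3 = 0 then g3 else e3)] : Fin 4 → ℕ) l * (1 + X l) ^ (![1, 0, (if b 2 = 0 then e2 else g2), (if b 3 = 0 then e3 else g3)] : Fin 4 → ℕ) l : MvPolynomial (Fin 4) (ZMod 2)) := by
  rw [step_F_of_purelyOdd (⟨(∏ l, X l ^ (![1, m, g2, g3] : Fin 4 → ℕ) l * (1 + X l) ^ (![1, 0, e2, e3] : Fin 4 → ℕ) l : MvPolynomial (Fin 4) (ZMod 2)), r, exc⟩ : State (ZMod 2)) (![1, m, g2, g3] : Fin 4 → ℕ)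
    (![1, 0, e2, e3] : Fin 4 → ℕ) rfl (j := 1) (by simp; omega) b (k := 1) (by simp [hb]; omega) (by simp [hb])]
  refine Finset.prod_congr rfl fun l _ => ?_
  fin_cases l <;> simp [hb]

/-- **THE FAMILY `A_m = x₀x₁^m(1+x₀)·S²` IS WINNING** for every odd `m`, every even dress, every booking. [OURS · counted 0] [folklore] -/
theorem stateWins_A : ∀ n : ℕ, ∀ m g2 g3 e2 e3 : ℕ, m % 2 = 1 → m ≤ 2 * n + 1 →
    g2 % 2 = 0 → g3 % 2 = 0 → e2 % 2 = 0 → e3 % 2 = 0 → ∀ (r : Fin 4 →₀ ℕ) (exc : Finset (Fin 4)),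
      StateWins 2 (⟨(∏ l, X l ^ (![1, m, g2, g3] : Fin 4 → ℕ) l * (1 + X l) ^ (![1, 0, e2, e3] : Fin 4 → ℕ) l : MvPolynomial (Fin 4) (ZMod 2)), r, exc⟩ : State (ZMod 2)) := by
  intro n
  induction n with
  | zero =>
    intro m g2 g3 e2 e3 hm hle hg2 hg3 he2 he3 r exc
    obtain rfl : m = 1 := by omega
    exact stateWins_pair_A1 g2 g3 e2 e3 hg2 hg3 he2 he3 r exc
  | succ n IH =>
    intro m g2 g3 e2 e3 hm hle hg2 hg3 he2 he3 r exc
    by_cases hm1 : m = 1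
    · subst hm1; exact stateWins_pair_A1 g2 g3 e2 e3 hg2 hg3 he2 he3 r exc
    have hm3 : 3 ≤ m := by omega
    have hstate : ∀ t : State (ZMod 2), t = ⟨t.F, t.r, t.exc⟩ := fun t => rfl
    have hP : ∀ n : ℕ, n % 2 = 0 → ∀ n' : ℕ, n' % 2 = 0 → ∀ z : ZMod 2, (if z = 0 then n else n') % 2 = 0 := by
      intro n hn n' hn' z; split_ifs <;> assumption
    unfold StateWins
    refine Game.Wins.move (m := ({1} : Finset (Fin 4))) ⟨Finset.singleton_nonempty 1, ?_⟩ ?_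
    · show (2 : ℕ∞) ≤ ordAlong {1} (∏ l, X l ^ (![1, m, g2, g3] : Fin 4 → ℕ) l * (1 + X l) ^ (![1, 0, e2, e3] : Fin 4 → ℕ) l : MvPolynomial (Fin 4) (ZMod 2))
      rw [ordAlong_prod, degIn_singleton]
      simpa using (show (2 : ℕ∞) ≤ (m : ℕ∞) by exact_mod_cast (by omega : 2 ≤ m))
    rintro s' ⟨j', b, hj', hbj, -, -, rfl⟩
    rw [Finset.mem_singleton] at hj'
    subst hj'
    rw [hstate (step 2 _ _ b _), step_F_grind1_A m g2 g3 e2 e3 hm hm3 b hbj r exc]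
    exact IH (m - 2) _ _ _ _ (by omega) (by omega) (hP _ hg2 _ he2 _) (hP _ hg3 _ he3 _) (hP _ he2 _ hg2 _) (hP _ he3 _ hg3 _) _ _

/-! ## 4. The unit leaves `x^a(1+x₀)` with `a₀ = 1`, `a₁` odd, `a₂, a₃` even -/

/-- **UNIFORM THEOREM (unit leaves, `a₀ = 1`, one odd partner).** For every exponent vector `a` with `a₀ = 1`, `a₁` odd and
`a₂, a₃` even, and every booking, the unit leaf `x^a·(1+x₀)` is an A-WIN of the plain game over `𝔽₂`. [OURS · counted 0 · ‖ K]
[folklore] -/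
theorem stateWins_unitLeaf_oneOdd (a : Fin 4 → ℕ) (h0 : a 0 = 1) (h1 : a 1 % 2 = 1) (h2 : a 2 % 2 = 0) (h3 : a 3 % 2 = 0)
    (r : Fin 4 →₀ ℕ) (exc : Finset (Fin 4)) :
    StateWins 2 (⟨monomial (Finsupp.equivFunOnFinite.symm a) 1 * (1 + X 0), r, exc⟩ : State (ZMod 2)) := by
  have ha : a = (![1, a 1, a 2, a 3] : Fin 4 → ℕ) := by
    funext l; fin_cases l <;> simp [h0]
  have hF : (monomial (Finsupp.equivFunOnFinite.symm a) 1 * (1 + X 0) : MvPolynomial (Fin 4) (ZMod 2)) =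
      (∏ l, X l ^ (![1, (a 1), (a 2), (a 3)] : Fin 4 → ℕ) l * (1 + X l) ^ (![1, 0, 0, 0] : Fin 4 → ℕ) l : MvPolynomial (Fin 4) (ZMod 2)) := by
    rw [prod_eq_monomial_mul, Fin.prod_univ_four, ha]
    simp
  rw [hF]
  exact stateWins_A (a 1) (a 1) (a 2) (a 3) 0 0 h1 (by omega) h2 h3 (by decide) (by decide) r exc

/-- … stated with the dress: `x₀x₁^m x₂^{g₂}(1+x₂)^{e₂} x₃^{g₃}(1+x₃)^{e₃}(1+x₀)` wins for `m` odd and `g₂ g₃ e₂ e₃` even. [OURS · counted 0] [folklore] -/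
theorem stateWins_unitLeaf_oneOdd_dressed (m g2 g3 e2 e3 : ℕ) (hm : m % 2 = 1) (hg2 : g2 % 2 = 0) (hg3 : g3 % 2 = 0) (he2 : e2 % 2 = 0) (he3 : e3 % 2 = 0)
    (r : Fin 4 →₀ ℕ) (exc : Finset (Fin 4)) :
    StateWins 2 (⟨(∏ l, X l ^ (![1, m, g2, g3] : Fin 4 → ℕ) l * (1 + X l) ^ (![1, 0, e2, e3] : Fin 4 → ℕ) l : MvPolynomial (Fin 4) (ZMod 2)), r, exc⟩ : State (ZMod 2)) :=
  stateWins_A m m g2 g3 e2 e3 hm (by omega) hg2 hg3 he2 he3 r exc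

end PureLeafNF

end Summit.ResolutionOfSingularities.ResolutionOfSingularities.Theorems.PIDim4

end
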